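import Literature.MathematicalPhysics.QuantumFieldTheory.Balaban1983to89.B9Ineq349Hom

/-!
# `Balaban1983to89.B9Ineq349WordDiffHom` — [Balaban1985BackgroundPropagators] (3.49)₄ p. 399 FOR THE DIFFERENCE OF THE (3.25) WORD
# `G′Q′*(Q′G′²Q′*)⁻¹Q′G′` AT TWO LETTER TABLES, between the derivative letters `D`, `D*`: a LETTER-FREE ENGINE — the five-term telescope, each summand ONE
# differenced letter carrying a small constant, composed by [4] Lemma 2.1 exactly as r06's `B9Ineq349Hom.hasMajorantHom_word349` (junction J-B, bond sector,
# FILE 2a; consumer: the bond-sector knit∕taxicab junction `Δ_a(U; parKnitY) − Δ_a(U; parSymY) = D_U(R_knit − R_sym)D*_U` of t2s-1's `B9B8KnitBondResolvent`)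

T. Bałaban, *Propagators for lattice gauge theories in a background field*, Commun. Math. Phys. **99** (1985) 389–434
[`Balaban1985BackgroundPropagators`, "B9"]; [4] = T. Bałaban, *Propagators and renormalization transformations for lattice gauge
theories. II*, Commun. Math. Phys. **96** (1984) 223–250 [`Balaban1984PropagatorsII`].

statement-level skeleton of published theorems with citation tags; proofs where landed; nothing here is a claim about the
Yang–Mills mass gap

THE PRINTED LOCUS (verbatim up to notation; page owner r06).  (3.25) p. 394–395: «Rf = (I − G′Q′\*(Q′G′²Q′\*)⁻¹Q′G′)f»; (3.26) p. 395: «Δ_a = Δ + DRD\* + Q\*aQ»;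
(3.49) p. 399: «[|P(x,x′)|, |(DP)_μ(x,x′)|, |(PD\*)_ν(x,x′)|, |(DPD\*)_{μν}(x,x′)|] ≦ O(1)[1, (Lʲη)⁻¹, (Lʲη)⁻¹, (Lʲη)⁻²](L^{j′}η)^{−d}e^{−(1/2)δ₀d(y,y′)}»
with «using again Lemma 2.1»; (3.19) p. 393 (the averaging contours «(52), (53) in [5]») versus (3.40) p. 397 («Γ_{x,x′} a shortest contour») — in print ONE
transporter convention; (3.106) p. 414 («G = G₀(I − R)⁻¹», the resolvent device); [4] (2.50)–(2.55) p. 232, Lemma 2.1 (2.60)–(2.61) p. 234, p. 398 of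
[B9] (scale-transfer remark).

WHY THIS FILE (cell `lit-balaban`; seat p38 gen 46; lead g34 RULING JUNCTION-PARS (T) CONFIRMED 2026-08-28T23:20Z «p38 = (T)'s estimate files 2+»; t2s-1 g10
`JB-BOND-DESIGN.md`).  The [B8] Thm 2 torus supplier needs `Δ_a(U)` at print's knit transporters `parKnitY` while the whole G-B9-LETTERS supply (M5.1b-G →
M5.7) is typed at def-Y's letter of record `parSymY`; t2s-1's FILE 1 `B9B8KnitBondResolvent` reduces the junction to ONE located estimate, a block majorant of
`E = D_U(R(U; par₁) − R(U; par₂))D*_U`, and gives the five-term telescope of the (3.25) word `W_j = G′_jQ′*_j X_j⁻¹Q′_jG′_j` with exactly one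
differenced letter per summand (`RY_sub_RY_telescope`, `word_sub_word_telescope`).  THIS FILE is the letter-free half of that estimate: for abstract
letters between their own carriers — `X_j = D∘G′_j` (sites → bonds), `Y_j = G′_j∘D*` (bonds → sites), `Q′_j` (sites → blocks), `Q′*_j` (blocks → sites),
`X_j⁻¹` (blocks) — with majorants of the printed shapes for the UNdifferenced letters ((3.42)₂,₃, (3.19), (3.48)) and majorants of the SAME shapes with
small constants for the DIFFERENCED ones (junction J-B files 8∕9∕10∕23a–c supply them at `(parSymY, parKnitY)`: `G′` by the resolvent identity with the
block-diagonal `Δ′_sym − Δ′_knit`, `Q′`∕`Q′*` by file 23a, `X⁻¹` by file 23b's `X_sym − X_knit` and the second resolvent identity), it proves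
`D(W₁ − W₂)D* ≺ κ_diff·ℓ(a)⁻²·e^{−ρd}`, `κ_diff` EXPLICIT and linear in the five small constants — one application of r06's generic-end-letter engine `hasMajorantHom_word349₂` per
summand (r06's two-constant sibling `hasMajorantHom_word349₂`, appended 2026-08-28 on this seat's ask, because in two summands exactly one of `Q′`, `Q′*` is
differenced).  §2 puts the three composite
differenced letters (`D∘G′₂∘E∘G′₁`, `G′₂∘E∘G′₁∘D*`, `X₂⁻¹∘F∘X₁⁻¹`) into the standard shapes.  The member instantiation at `(parSymY, parKnitY)` is FILE 2b.

WHAT THIS FILE PROVES (THEOREMS; 0 `def`, 0 `def … : Prop`, 0 sorry; standard axioms).  Abstract `g : B9.Geometry` read through `toB6 g R H`, carriers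
`I` (bonds), `X` (sites), `Z` (blocks) with block maps.
* §1 `word_sub_word_telescope` (the realified five-term telescope, t2s-1's shape), `hasMajorantHom_sub`.
* §2 ★ `hasMajorantHom_leftDiff` (`X₂∘E∘G₁ ≺ (B_Xθ_EB₀Λc₁)·ℓ·e^{−ρd}` from `X₂ ≺ B_Xℓe^{−δd}`, `E ≺ θ_E𝟙`, `G₁ ≺ B₀ℓ²e^{−δd}`, `ℓ ≤ 1`, the transfer of `ℓ²`, (2.61),
  `ρ + (α+β)δ₀ ≤ δ`), ★ `hasMajorantHom_rightDiff` (`G₂∘E∘Y₁ ≺ (B₀θ_EB_YΛc₁)·ℓ·e^{−ρd}`, the transfer of `ℓ`), ★ `hasMajorant_cinvDiff`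
  (`C₂∘F∘C₁ ≺ (B₁²θ_FΛc₁²)·ℓ⁻⁴·e^{−ρd}` from `F ≺ θ_Fℓ⁴e^{−δd}`, `C_j ≺ B₁ℓ⁻⁴e^{−δd}`, the transfer of `ℓ⁻⁴`, `ρ + 2(α+β)δ₀ ≤ δ` — J-B 23c's remainder shape).
* §3 ★★★ `hasMajorant_wordDiff349` — from `hX₂ : X₂ ≺ B_Xℓe^{−δd}`, `hdX : (X₁ − X₂) ≺ θ_Xℓe^{−δd}`, `hY₁ : Y₁ ≺ B_Yℓe^{−δd}`, `hdY : (Y₁ − Y₂) ≺ θ_Yℓe^{−δd}`,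
  `hQ₁, hQ₂, hQs₁, hQs₂ : κ_Q𝟙`, `hdQ : (Q₁ − Q₂) ≺ θ_Q𝟙`, `hdQs : (Q*₁ − Q*₂) ≺ θ_Q𝟙`, `hC₁, hC₂ : B₁ℓ⁻⁴e^{−δd}`, `hdC : (C₁ − C₂) ≺ θ_Cℓ⁻⁴e^{−δd}`, (2.54),
  (2.61) at `β`, the transfers of `ℓ` and `ℓ⁻⁴` at `α` (`Λ ≥ 1`), `ρ + (2α+β)δ₀ ≤ δ`, `ℓ > 0`:
  `X₁∘Q*₁∘C₁∘Q₁∘Y₁ − X₂∘Q*₂∘C₂∘Q₂∘Y₂ ≺ Λ⁴c₁²·(κ_Q²θ_XB₁B_Y + κ_Qθ_QB_XB₁B_Y + κ_Q²B_Xθ_CB_Y + κ_Qθ_QB_XB₁B_Y + κ_Q²B_XB₁θ_Y)·ℓ(a)⁻²·e^{−ρd}` over `blkI` — each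
  summand of the telescope one r06 `hasMajorantHom_word349₂`; letters LEFT of the differenced one are table-2 letters, RIGHT of it table-1 letters (so at
  `(par₁, par₂) = (parSymY, parKnitY)` only LEFT entries `D∘G′_knit` (J-B file 10) and RIGHT entries `G′_sym∘D*` (M5.5) are needed).

HONEST SCOPE ∕ NOT CLAIMED.  Pure [4] (2.51)–(2.55)∕Lemma 2.1 bookkeeping on abstract letters; every majorant is a HYPOTHESIS here; no def-Y letter, no
transporter, no configuration appears (FILE 2b instantiates).  Print has ONE transporter convention — the junction and this difference estimate are a
formalisation artefact of def-Y's two letters (`parSymY` of record vs the knit's `parKnitY` forced by the Landau condition (1.38)), priced by the J-B files.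
NOT a node discharge; no summit ∕ sub-problem statement is proved; nothing continuum ∕ OS ∕ mass-gap ∕ Clay; YM mass gap NOT proved by any of this (Track A
conditional rung).  No `sorry`, no `axiom`, no `… : Prop` fact, no `instance`, no `notation`, no `def`.  NEW file; nothing landed is modified.  `--supports
stmt-QuantumFields-19200` as helper.  Net new unproved facts: 0.

RELATED IN THE TREE, NOT DUPLICATED (searched 2026-08-28: `rg 'word349' Literature/` = r06 `B9Ineq349Hom` ∕ `B9Ineq368PPrime` (USED BY NAME:
`hasMajorantHom_word349₂` (p677672), `hasMajorantHom_comp_decay`, `hasMajorantHom_local_comp`, `hasMajorantHom_rate_mono`, `scaleTransfer_one`); `rg 'WordDiff|wordDiff'` = ∅): t2s-1 `B9B8KnitBondResolvent` (the telescope at def-Y's letters, FILE 1), p33 junction J-B files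
`B9B8KnitLetterResolvent` ∕ `…MajorantTransfer` ∕ `…EntriesTransfer` ∕ `…QpDiff` ∕ `…XDiffMajorant` ∕ `…CinvTransfer` (the site-sector suppliers of the small
constants), r06 `B9Ineq349Hom` (the engine).
-/

noncomputable section

namespace Literature.MathematicalPhysics.QuantumFieldTheory.Balaban1983to89.B9Ineq349WordDiffHom

open B6RandomWalk (HasMajorant hasMajorant_mono hasMajorant_add Triangle254 Ineq261 c1_nonneg)
open B6RandomWalkHom (HasMajorantHom hasMajorantHom_mono hasMajorantHom_comp hasMajorantHom_iff hasMajorantHom_add)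
open B9Thm34Ext (toB6)
open B9Ineq347 (ScaleTransfer)
open B9Ineq366CPrime (scaleTransfer_one)
open B9Ineq349Hom (hasMajorantHom_word349₂ hasMajorantHom_comp_decay hasMajorantHom_local_comp hasMajorantHom_rate_mono)

/-! ## §1  The telescope; differences of two-space letters -/

section Algebra

variable {I X Z : Type}

/-- **THE FIVE-TERM TELESCOPE** (realified, abstract letters): `W₁ − W₂ = (X₁−X₂)Q*₁C₁Q₁Y₁ + X₂(Q*₁−Q*₂)C₁Q₁Y₁ + X₂Q*₂(C₁−C₂)Q₁Y₁ + X₂Q*₂C₂(Q₁−Q₂)Y₁ +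
X₂Q*₂C₂Q₂(Y₁−Y₂)` — each summand ONE differenced letter, table-2 letters to its left, table-1 letters to its right (t2s-1's `word_sub_word_telescope`, real form).
[cite: Balaban1985BackgroundPropagators, (3.25) p.395; Balaban1984PropagatorsII, (2.50) p.232, bookkeeping] -/
theorem word_sub_word_telescope (X₁ X₂ : (X → ℝ) →ₗ[ℝ] (I → ℝ)) (Qs₁ Qs₂ : (Z → ℝ) →ₗ[ℝ] (X → ℝ)) (C₁ C₂ : Module.End ℝ (Z → ℝ))
    (Q₁ Q₂ : (X → ℝ) →ₗ[ℝ] (Z → ℝ)) (Y₁ Y₂ : (I → ℝ) →ₗ[ℝ] (X → ℝ)) :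
    X₁ ∘ₗ Qs₁ ∘ₗ C₁ ∘ₗ Q₁ ∘ₗ Y₁ - X₂ ∘ₗ Qs₂ ∘ₗ C₂ ∘ₗ Q₂ ∘ₗ Y₂ =
      (X₁ - X₂) ∘ₗ Qs₁ ∘ₗ C₁ ∘ₗ Q₁ ∘ₗ Y₁ + X₂ ∘ₗ (Qs₁ - Qs₂) ∘ₗ C₁ ∘ₗ Q₁ ∘ₗ Y₁ + X₂ ∘ₗ Qs₂ ∘ₗ (C₁ - C₂) ∘ₗ Q₁ ∘ₗ Y₁
        + X₂ ∘ₗ Qs₂ ∘ₗ C₂ ∘ₗ (Q₁ - Q₂) ∘ₗ Y₁ + X₂ ∘ₗ Qs₂ ∘ₗ C₂ ∘ₗ Q₂ ∘ₗ (Y₁ - Y₂) := by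
  simp only [LinearMap.sub_comp, LinearMap.comp_sub]
  abel

end Algebra

section Calculus

variable {g : B9.Geometry} [Fintype g.Site] [DecidableEq g.Site] {R : ℝ} {H : Prop} {I O X Z : Type}

omit [DecidableEq g.Site] in
/-- a difference of two-space letters has the sum of the majorants ([4] p.232 «A summation preserves it also»). [cite: Balaban1984PropagatorsII, (2.51)–(2.52) p.232] -/
theorem hasMajorantHom_sub (blkX : X → g.Site) (blkY : I → g.Site) {T₁ T₂ : (X → ℝ) →ₗ[ℝ] (I → ℝ)} {K₁ K₂ : g.Site → g.Site → ℝ}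
    (h₁ : HasMajorantHom (g := toB6 g R H) blkX blkY T₁ K₁) (h₂ : HasMajorantHom (g := toB6 g R H) blkX blkY T₂ K₂) :
    HasMajorantHom (g := toB6 g R H) blkX blkY (T₁ - T₂) (fun a b => K₁ a b + K₂ a b) := by
  intro y' μ B hμ v
  rw [LinearMap.sub_apply, Pi.sub_apply, add_mul]
  exact (abs_sub _ _).trans (add_le_add (h₁ y' μ B hμ v) (h₂ y' μ B hμ v))

/-! ## §2  The three composite differenced letters in the standard shapes -/

omit [DecidableEq g.Site] in
/-- ★ **THE LEFT DIFFERENCED END LETTER**: `X₂ ≺ B_Xℓe^{−δd}` (a left entry `D∘G′₂`), `E ≺ θ_E𝟙` (block-diagonal, the two Laplacians' difference), `G₁ ≺ B₀ℓ²e^{−δd}`,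
`ℓ ≤ 1`, the transfer of `ℓ²` at `α`, (2.61) at `β`, `ρ + (α+β)δ₀ ≤ δ` ⟹ `X₂∘E∘G₁ ≺ (B_Xθ_EB₀Λc₁)·ℓ(a)·e^{−ρd}` — the shape of a left entry with a SMALL constant
(`D∘(G′₁ − G′₂) = D∘G′₂∘(Δ′₂ − Δ′₁)∘G′₁` by the second resolvent identity).
[cite: Balaban1985BackgroundPropagators, (3.42) p.397, (3.106) p.414, p.398 (remark after (3.47)); Balaban1984PropagatorsII, (2.50)–(2.52) p.232, Lemma 2.1 (2.61) p.234] -/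
theorem hasMajorantHom_leftDiff [DecidableEq g.Site] (blkX : X → g.Site) (blkI : I → g.Site) (d : ℕ) (δ₀ δ α β ρ Λ BX θE B₀ : ℝ)
    (hBX : 0 ≤ BX) (hθE : 0 ≤ θE) (hB₀ : 0 ≤ B₀) (hΛ : 0 ≤ Λ) (hρ : 0 ≤ ρ) (hα : 0 ≤ α) (hβ : 0 ≤ β) (hδ₀ : 0 ≤ δ₀) (hr : ρ + (α + β) * δ₀ ≤ δ)
    (hdnn : ∀ a b : g.Site, 0 ≤ g.dist a b) (htri : Triangle254 (toB6 g R H)) (hlen : ∀ a, 0 < g.len a) (hℓ1 : ∀ a, g.len a ≤ 1)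
    (h261 : Ineq261 d (toB6 g R H) δ₀ β) (hT2 : ScaleTransfer g δ₀ α Λ (fun a => g.len a ^ 2))
    {X₂ : (X → ℝ) →ₗ[ℝ] (I → ℝ)} {E G₁ : Module.End ℝ (X → ℝ)}
    (hX₂ : HasMajorantHom (g := toB6 g R H) blkX blkI X₂ (fun a b => BX * g.len a * Real.exp (-(δ * g.dist a b))))
    (hE : HasMajorant (g := toB6 g R H) blkX E (fun a b : g.Site => if a = b then θE else 0))
    (hG₁ : HasMajorant (g := toB6 g R H) blkX G₁ (fun a b => B₀ * g.len a ^ 2 * Real.exp (-(δ * g.dist a b)))) :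
    HasMajorantHom (g := toB6 g R H) blkX blkI (X₂ ∘ₗ E ∘ₗ G₁) (fun a b => (BX * θE * B₀ * Λ * B6.c1 d δ₀ β) * g.len a * Real.exp (-(ρ * g.dist a b))) := by
  have hc0 : 0 ≤ B6.c1 d δ₀ β := c1_nonneg d δ₀ β
  have hw1 : ∀ a : g.Site, 0 ≤ g.len a := fun a => (hlen a).le
  have hw2 : ∀ a : g.Site, 0 ≤ g.len a ^ 2 := fun a => sq_nonneg _
  have hρδ : ρ ≤ δ := by
    have : 0 ≤ (α + β) * δ₀ := by positivity
    linarith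
  have hE' : HasMajorantHom (g := toB6 g R H) blkX blkX E (fun a b : g.Site => if a = b then θE else 0) :=
    (hasMajorantHom_iff (g := toB6 g R H) blkX E _).mpr hE
  have hG₁' : HasMajorantHom (g := toB6 g R H) blkX blkX G₁ (fun a b => B₀ * g.len a ^ 2 * Real.exp (-(ρ * g.dist a b))) :=
    hasMajorantHom_rate_mono (R := R) (H := H) blkX blkX B₀ (fun a => g.len a ^ 2) hB₀ hw2 hρδ hdnn
      ((hasMajorantHom_iff (g := toB6 g R H) blkX G₁ _).mpr hG₁)
  have hK : ∀ a b : g.Site, 0 ≤ B₀ * g.len a ^ 2 * Real.exp (-(ρ * g.dist a b)) := fun a b => by positivity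
  have s1 : HasMajorantHom (g := toB6 g R H) blkX blkX (E ∘ₗ G₁) (fun a b => (θE * B₀) * g.len a ^ 2 * Real.exp (-(ρ * g.dist a b))) :=
    hasMajorantHom_mono (g := toB6 g R H) blkX blkX
      (hasMajorantHom_local_comp (R := R) (H := H) blkX blkX blkX θE hK hE' hG₁') fun a b => le_of_eq (by ring)
  have s2 := hasMajorantHom_comp_decay (R := R) (H := H) blkX blkX blkI d δ₀ α β ρ δ Λ BX (θE * B₀) (fun a => g.len a) (fun a => g.len a ^ 2)
    hw1 hw2 hΛ hBX (mul_nonneg hθE hB₀) hρ hr hdnn htri hT2 h261 hX₂ s1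
  refine hasMajorantHom_mono (g := toB6 g R H) blkX blkI s2 fun a b => ?_
  have hl3 : g.len a * g.len a ^ 2 ≤ g.len a := by
    have h1 : g.len a ^ 2 ≤ 1 := by nlinarith [hw1 a, hℓ1 a]
    nlinarith [hw1 a]
  have hC : 0 ≤ BX * (θE * B₀) * Λ * B6.c1 d δ₀ β := by positivity
  calc BX * (θE * B₀) * Λ * B6.c1 d δ₀ β * (g.len a * g.len a ^ 2) * Real.exp (-(ρ * g.dist a b))
      ≤ BX * (θE * B₀) * Λ * B6.c1 d δ₀ β * g.len a * Real.exp (-(ρ * g.dist a b)) :=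
        mul_le_mul_of_nonneg_right (mul_le_mul_of_nonneg_left hl3 hC) (Real.exp_nonneg _)
    _ = _ := by ring

omit [DecidableEq g.Site] in
/-- ★ **THE RIGHT DIFFERENCED END LETTER**: `G₂ ≺ B₀ℓ²e^{−δd}`, `E ≺ θ_E𝟙`, `Y₁ ≺ B_Yℓe^{−δd}` (a right entry `G′₁∘D*`), `ℓ ≤ 1`, the transfer of `ℓ` at `α`, (2.61) at `β`,
`ρ + (α+β)δ₀ ≤ δ` ⟹ `G₂∘E∘Y₁ ≺ (B₀θ_EB_YΛc₁)·ℓ(a)·e^{−ρd}` (`(G′₁ − G′₂)∘D* = G′₂∘(Δ′₂ − Δ′₁)∘G′₁∘D*`).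
[cite: Balaban1985BackgroundPropagators, (3.42) p.397, (3.106) p.414, p.398 (remark after (3.47)); Balaban1984PropagatorsII, (2.50)–(2.52) p.232, Lemma 2.1 (2.61) p.234] -/
theorem hasMajorantHom_rightDiff [DecidableEq g.Site] (blkI : I → g.Site) (blkX : X → g.Site) (d : ℕ) (δ₀ δ α β ρ Λ B₀ θE BY : ℝ)
    (hB₀ : 0 ≤ B₀) (hθE : 0 ≤ θE) (hBY : 0 ≤ BY) (hΛ : 0 ≤ Λ) (hρ : 0 ≤ ρ) (hα : 0 ≤ α) (hβ : 0 ≤ β) (hδ₀ : 0 ≤ δ₀) (hr : ρ + (α + β) * δ₀ ≤ δ)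
    (hdnn : ∀ a b : g.Site, 0 ≤ g.dist a b) (htri : Triangle254 (toB6 g R H)) (hlen : ∀ a, 0 < g.len a) (hℓ1 : ∀ a, g.len a ≤ 1)
    (h261 : Ineq261 d (toB6 g R H) δ₀ β) (hT1 : ScaleTransfer g δ₀ α Λ (fun a => g.len a))
    {G₂ E : Module.End ℝ (X → ℝ)} {Y₁ : (I → ℝ) →ₗ[ℝ] (X → ℝ)}
    (hG₂ : HasMajorant (g := toB6 g R H) blkX G₂ (fun a b => B₀ * g.len a ^ 2 * Real.exp (-(δ * g.dist a b))))
    (hE : HasMajorant (g := toB6 g R H) blkX E (fun a b : g.Site => if a = b then θE else 0))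
    (hY₁ : HasMajorantHom (g := toB6 g R H) blkI blkX Y₁ (fun a b => BY * g.len a * Real.exp (-(δ * g.dist a b)))) :
    HasMajorantHom (g := toB6 g R H) blkI blkX (G₂ ∘ₗ E ∘ₗ Y₁) (fun a b => (B₀ * θE * BY * Λ * B6.c1 d δ₀ β) * g.len a * Real.exp (-(ρ * g.dist a b))) := by
  have hc0 : 0 ≤ B6.c1 d δ₀ β := c1_nonneg d δ₀ β
  have hw1 : ∀ a : g.Site, 0 ≤ g.len a := fun a => (hlen a).le
  have hw2 : ∀ a : g.Site, 0 ≤ g.len a ^ 2 := fun a => sq_nonneg _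
  have hρδ : ρ ≤ δ := by
    have : 0 ≤ (α + β) * δ₀ := by positivity
    linarith
  have hE' : HasMajorantHom (g := toB6 g R H) blkX blkX E (fun a b : g.Site => if a = b then θE else 0) :=
    (hasMajorantHom_iff (g := toB6 g R H) blkX E _).mpr hE
  have hG₂' : HasMajorantHom (g := toB6 g R H) blkX blkX G₂ (fun a b => B₀ * g.len a ^ 2 * Real.exp (-(δ * g.dist a b))) :=
    (hasMajorantHom_iff (g := toB6 g R H) blkX G₂ _).mpr hG₂
  have hY₁' : HasMajorantHom (g := toB6 g R H) blkI blkX Y₁ (fun a b => BY * g.len a * Real.exp (-(ρ * g.dist a b))) :=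
    hasMajorantHom_rate_mono (R := R) (H := H) blkI blkX BY (fun a => g.len a) hBY hw1 hρδ hdnn hY₁
  have hK : ∀ a b : g.Site, 0 ≤ BY * g.len a * Real.exp (-(ρ * g.dist a b)) := fun a b => by have := hw1 a; positivity
  have s1 : HasMajorantHom (g := toB6 g R H) blkI blkX (E ∘ₗ Y₁) (fun a b => (θE * BY) * g.len a * Real.exp (-(ρ * g.dist a b))) :=
    hasMajorantHom_mono (g := toB6 g R H) blkI blkX
      (hasMajorantHom_local_comp (R := R) (H := H) blkI blkX blkX θE hK hE' hY₁') fun a b => le_of_eq (by ring)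
  have s2 := hasMajorantHom_comp_decay (R := R) (H := H) blkI blkX blkX d δ₀ α β ρ δ Λ B₀ (θE * BY) (fun a => g.len a ^ 2) (fun a => g.len a)
    hw2 hw1 hΛ hB₀ (mul_nonneg hθE hBY) hρ hr hdnn htri hT1 h261 hG₂' s1
  refine hasMajorantHom_mono (g := toB6 g R H) blkI blkX s2 fun a b => ?_
  have hl3 : g.len a ^ 2 * g.len a ≤ g.len a := by
    have h1 : g.len a ^ 2 ≤ 1 := by nlinarith [hw1 a, hℓ1 a]
    nlinarith [hw1 a]
  have hC : 0 ≤ B₀ * (θE * BY) * Λ * B6.c1 d δ₀ β := by positivity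
  calc B₀ * (θE * BY) * Λ * B6.c1 d δ₀ β * (g.len a ^ 2 * g.len a) * Real.exp (-(ρ * g.dist a b))
      ≤ B₀ * (θE * BY) * Λ * B6.c1 d δ₀ β * g.len a * Real.exp (-(ρ * g.dist a b)) :=
        mul_le_mul_of_nonneg_right (mul_le_mul_of_nonneg_left hl3 hC) (Real.exp_nonneg _)
    _ = _ := by ring

omit [DecidableEq g.Site] in
/-- ★ **THE DIFFERENCED INVERSE LETTER**: `C_j ≺ B₁ℓ⁻⁴e^{−δd}` ((3.48) at both tables), `F ≺ θ_Fℓ⁴e^{−δd}` (the difference `X₁ − X₂` of `X = Q′G′²Q′*`, J-B 23b's shape),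
the transfer of `ℓ⁻⁴` at `α` (`Λ ≥ 1`), (2.61) at `β`, `ρ + 2(α+β)δ₀ ≤ δ` ⟹ `C₂∘F∘C₁ ≺ (B₁²θ_FΛc₁²)·ℓ(a)⁻⁴·e^{−ρd}` — the (3.48) shape with a SMALL constant
(`C₁ − C₂ = C₂∘(X₂ − X₁)∘C₁`, second resolvent identity).
[cite: Balaban1985BackgroundPropagators, (3.48) p.398, (3.106) p.414, p.398 (remark after (3.47)); Balaban1984PropagatorsII, (2.50)–(2.52) p.232, Lemma 2.1 (2.61) p.234] -/
theorem hasMajorant_cinvDiff (blkZ : Z → g.Site) (d : ℕ) (δ₀ δ α β ρ Λ B₁ θF : ℝ)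
    (hB₁ : 0 ≤ B₁) (hθF : 0 ≤ θF) (hΛ : 1 ≤ Λ) (hρ : 0 ≤ ρ) (hα : 0 ≤ α) (hβ : 0 ≤ β) (hδ₀ : 0 ≤ δ₀) (hr : ρ + 2 * (α + β) * δ₀ ≤ δ)
    (hdnn : ∀ a b : g.Site, 0 ≤ g.dist a b) (htri : Triangle254 (toB6 g R H)) (hlen : ∀ a, 0 < g.len a)
    (h261 : Ineq261 d (toB6 g R H) δ₀ β) (hT4 : ScaleTransfer g δ₀ α Λ (fun a => (g.len a ^ 4)⁻¹))
    {C₁ C₂ F : Module.End ℝ (Z → ℝ)}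
    (hC₁ : HasMajorant (g := toB6 g R H) blkZ C₁ (fun a b => B₁ * (g.len a ^ 4)⁻¹ * Real.exp (-(δ * g.dist a b))))
    (hC₂ : HasMajorant (g := toB6 g R H) blkZ C₂ (fun a b => B₁ * (g.len a ^ 4)⁻¹ * Real.exp (-(δ * g.dist a b))))
    (hF : HasMajorant (g := toB6 g R H) blkZ F (fun a b => θF * g.len a ^ 4 * Real.exp (-(δ * g.dist a b)))) :
    HasMajorant (g := toB6 g R H) blkZ (C₂ ∘ₗ F ∘ₗ C₁)
      (fun a b => (B₁ * B₁ * θF * Λ * B6.c1 d δ₀ β ^ 2) * (g.len a ^ 4)⁻¹ * Real.exp (-(ρ * g.dist a b))) := by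
  have hc0 : 0 ≤ B6.c1 d δ₀ β := c1_nonneg d δ₀ β
  have hΛ0 : 0 ≤ Λ := zero_le_one.trans hΛ
  have hw4 : ∀ a : g.Site, 0 ≤ (g.len a ^ 4)⁻¹ := fun a => inv_nonneg.mpr (by positivity)
  have hw4' : ∀ a : g.Site, 0 ≤ g.len a ^ 4 := fun a => by positivity
  have hab : 0 ≤ (α + β) * δ₀ := by nlinarith
  -- the intermediate rate of the inner product `F∘C₁`
  set ρ₁ : ℝ := ρ + (α + β) * δ₀ with hρ₁
  have hρ₁0 : 0 ≤ ρ₁ := by rw [hρ₁]; positivity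
  have hr₁ : ρ₁ + (α + β) * δ₀ ≤ δ := by rw [hρ₁]; linarith
  have hr₀ : ρ + (α + β) * δ₀ ≤ δ := by linarith
  have hρ₁δ : ρ₁ ≤ δ := by linarith
  have hC₁' : HasMajorantHom (g := toB6 g R H) blkZ blkZ C₁ (fun a b => B₁ * (g.len a ^ 4)⁻¹ * Real.exp (-(ρ₁ * g.dist a b))) :=
    hasMajorantHom_rate_mono (R := R) (H := H) blkZ blkZ B₁ (fun a => (g.len a ^ 4)⁻¹) hB₁ hw4 hρ₁δ hdnn
      ((hasMajorantHom_iff (g := toB6 g R H) blkZ C₁ _).mpr hC₁)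
  have hF' : HasMajorantHom (g := toB6 g R H) blkZ blkZ F (fun a b => θF * g.len a ^ 4 * Real.exp (-(δ * g.dist a b))) :=
    (hasMajorantHom_iff (g := toB6 g R H) blkZ F _).mpr hF
  have hC₂' : HasMajorantHom (g := toB6 g R H) blkZ blkZ C₂ (fun a b => B₁ * (g.len a ^ 4)⁻¹ * Real.exp (-(δ * g.dist a b))) :=
    (hasMajorantHom_iff (g := toB6 g R H) blkZ C₂ _).mpr hC₂
  -- `F∘C₁ ≺ θ_FB₁Λc₁ · (ℓ⁴ℓ⁻⁴ = 1) · e^{−ρ₁d}`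
  have s1 := hasMajorantHom_comp_decay (R := R) (H := H) blkZ blkZ blkZ d δ₀ α β ρ₁ δ Λ θF B₁ (fun a => g.len a ^ 4) (fun a => (g.len a ^ 4)⁻¹)
    hw4' hw4 hΛ0 hθF hB₁ hρ₁0 hr₁ hdnn htri hT4 h261 hF' hC₁'
  have s1' : HasMajorantHom (g := toB6 g R H) blkZ blkZ (F ∘ₗ C₁) (fun a b => (θF * B₁ * Λ * B6.c1 d δ₀ β) * (1 : ℝ) * Real.exp (-(ρ₁ * g.dist a b))) := by
    refine hasMajorantHom_mono (g := toB6 g R H) blkZ blkZ s1 fun a b => le_of_eq ?_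
    rw [mul_inv_cancel₀ (pow_ne_zero 4 (hlen a).ne')]
  -- `C₂∘(F∘C₁)`: the constant weight transfers for free
  have hT0 : ScaleTransfer g δ₀ α 1 (fun _ : g.Site => (1 : ℝ)) := scaleTransfer_one (mul_nonneg hα hδ₀) hdnn
  have hr₂ : ρ + (α + β) * δ₀ ≤ δ := hr₀
  have s2 := hasMajorantHom_comp_decay (R := R) (H := H) blkZ blkZ blkZ d δ₀ α β ρ δ 1 B₁ (θF * B₁ * Λ * B6.c1 d δ₀ β)
    (fun a => (g.len a ^ 4)⁻¹) (fun _ => (1 : ℝ)) hw4 (fun _ => zero_le_one) zero_le_one hB₁ (by positivity) hρ hr₂ hdnn htri hT0 h261 hC₂'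
    (hasMajorantHom_rate_mono (R := R) (H := H) blkZ blkZ (θF * B₁ * Λ * B6.c1 d δ₀ β) (fun _ => (1 : ℝ)) (by positivity) (fun _ => zero_le_one)
      (by rw [hρ₁]; linarith) hdnn s1')
  refine (hasMajorantHom_iff (g := toB6 g R H) blkZ _ _).mp (hasMajorantHom_mono (g := toB6 g R H) blkZ blkZ s2 fun a b => le_of_eq ?_)
  ring

end Calculus

/-! ## §3  ★★★ The (3.49)₄ entry of the difference of the two (3.25) words -/

section Main

variable {g : B9.Geometry} [Fintype g.Site] [DecidableEq g.Site] {R : ℝ} {H : Prop} {I X Z : Type}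

/-- ★★★ **(3.49)₄ FOR THE DIFFERENCE OF THE (3.25) WORD AT TWO LETTER TABLES, BETWEEN `D` AND `D*`** (letter-free).  Letters between their carriers: left entries
`X_j : sites → bonds` (`= D∘G′_j`), right entries `Y_j : bonds → sites` (`= G′_j∘D*`), `Q′_j : sites → blocks`, `Q′*_j : blocks → sites`, `C_j = X_j⁻¹` on blocks.
HYPOTHESES: the UNdifferenced letters in the printed shapes — `X₂ ≺ B_Xℓe^{−δd}`, `Y₁ ≺ B_Yℓe^{−δd}` ((3.42)₂,₃), `Q′_j, Q′*_j ≺ κ_Q𝟙` ((3.19)), `C_j ≺ B₁ℓ⁻⁴e^{−δd}`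
((3.48)); the DIFFERENCED letters in the same shapes with small constants — `X₁ − X₂ ≺ θ_Xℓe^{−δd}`, `Y₁ − Y₂ ≺ θ_Yℓe^{−δd}`, `Q′₁ − Q′₂, Q′*₁ − Q′*₂ ≺ θ_Q𝟙`,
`C₁ − C₂ ≺ θ_Cℓ⁻⁴e^{−δd}`; geometry (2.54), (2.61) at `β`, the transfers of `ℓ`, `ℓ⁻⁴` at `α` (`Λ ≥ 1`), `ℓ > 0`, `ρ + (2α+β)δ₀ ≤ δ`.  CONCLUSION:
`X₁Q′*₁C₁Q′₁Y₁ − X₂Q′*₂C₂Q′₂Y₂ ≺ Λ⁴c₁²·(κ_Q²θ_XB₁B_Y + κ_Qθ_QB_XB₁B_Y + κ_Q²B_Xθ_CB_Y + κ_Qθ_QB_XB₁B_Y + κ_Q²B_XB₁θ_Y)·ℓ(a)⁻²·e^{−ρd}` over the bond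
blocks — the five-term telescope, one engine application per summand; table-2 letters left of the differenced letter, table-1 letters right of it.
[cite: Balaban1985BackgroundPropagators, (3.49) p.399, (3.25) p.395, (3.26) p.395, (3.106) p.414; Balaban1984PropagatorsII, (2.50)–(2.55) p.232, Lemma 2.1 (2.60)–(2.61) p.234] -/
theorem hasMajorant_wordDiff349 (blkI : I → g.Site) (blkX : X → g.Site) (blkZ : Z → g.Site) (d : ℕ)
    (δ₀ δ α β ρ Λ κQ θQ BX θX B₁ θC BY θY : ℝ)
    (hκQ : 0 ≤ κQ) (hθQ : 0 ≤ θQ) (hBX : 0 ≤ BX) (hθX : 0 ≤ θX) (hB₁ : 0 ≤ B₁) (hθC : 0 ≤ θC) (hBY : 0 ≤ BY) (hθY : 0 ≤ θY)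
    (hΛ : 1 ≤ Λ) (hρ : 0 ≤ ρ) (hα : 0 ≤ α) (hβ : 0 ≤ β) (hδ₀ : 0 ≤ δ₀) (hr : ρ + (2 * α + β) * δ₀ ≤ δ)
    (hdnn : ∀ a b : g.Site, 0 ≤ g.dist a b) (htri : Triangle254 (toB6 g R H)) (hlen : ∀ a, 0 < g.len a)
    (h261 : Ineq261 d (toB6 g R H) δ₀ β)
    (hT1 : ScaleTransfer g δ₀ α Λ (fun a => g.len a)) (hT4 : ScaleTransfer g δ₀ α Λ (fun a => (g.len a ^ 4)⁻¹))
    {X₁ X₂ : (X → ℝ) →ₗ[ℝ] (I → ℝ)} {Y₁ Y₂ : (I → ℝ) →ₗ[ℝ] (X → ℝ)} {Q₁ Q₂ : (X → ℝ) →ₗ[ℝ] (Z → ℝ)}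
    {Qs₁ Qs₂ : (Z → ℝ) →ₗ[ℝ] (X → ℝ)} {C₁ C₂ : Module.End ℝ (Z → ℝ)}
    (hX₂ : HasMajorantHom (g := toB6 g R H) blkX blkI X₂ (fun a b => BX * g.len a * Real.exp (-(δ * g.dist a b))))
    (hdX : HasMajorantHom (g := toB6 g R H) blkX blkI (X₁ - X₂) (fun a b => θX * g.len a * Real.exp (-(δ * g.dist a b))))
    (hY₁ : HasMajorantHom (g := toB6 g R H) blkI blkX Y₁ (fun a b => BY * g.len a * Real.exp (-(δ * g.dist a b))))
    (hdY : HasMajorantHom (g := toB6 g R H) blkI blkX (Y₁ - Y₂) (fun a b => θY * g.len a * Real.exp (-(δ * g.dist a b))))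
    (hQ₁ : HasMajorantHom (g := toB6 g R H) blkX blkZ Q₁ (fun a b : g.Site => if a = b then κQ else 0))
    (hQ₂ : HasMajorantHom (g := toB6 g R H) blkX blkZ Q₂ (fun a b : g.Site => if a = b then κQ else 0))
    (hQs₁ : HasMajorantHom (g := toB6 g R H) blkZ blkX Qs₁ (fun a b : g.Site => if a = b then κQ else 0))
    (hQs₂ : HasMajorantHom (g := toB6 g R H) blkZ blkX Qs₂ (fun a b : g.Site => if a = b then κQ else 0))
    (hdQ : HasMajorantHom (g := toB6 g R H) blkX blkZ (Q₁ - Q₂) (fun a b : g.Site => if a = b then θQ else 0))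
    (hdQs : HasMajorantHom (g := toB6 g R H) blkZ blkX (Qs₁ - Qs₂) (fun a b : g.Site => if a = b then θQ else 0))
    (hC₁ : HasMajorant (g := toB6 g R H) blkZ C₁ (fun a b => B₁ * (g.len a ^ 4)⁻¹ * Real.exp (-(δ * g.dist a b))))
    (hC₂ : HasMajorant (g := toB6 g R H) blkZ C₂ (fun a b => B₁ * (g.len a ^ 4)⁻¹ * Real.exp (-(δ * g.dist a b))))
    (hdC : HasMajorant (g := toB6 g R H) blkZ (C₁ - C₂) (fun a b => θC * (g.len a ^ 4)⁻¹ * Real.exp (-(δ * g.dist a b)))) :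
    HasMajorant (g := toB6 g R H) blkI (X₁ ∘ₗ Qs₁ ∘ₗ C₁ ∘ₗ Q₁ ∘ₗ Y₁ - X₂ ∘ₗ Qs₂ ∘ₗ C₂ ∘ₗ Q₂ ∘ₗ Y₂)
      (fun a b => (Λ ^ 4 * B6.c1 d δ₀ β ^ 2 *
          (κQ * κQ * θX * B₁ * BY + κQ * θQ * BX * B₁ * BY + κQ * κQ * BX * θC * BY + θQ * κQ * BX * B₁ * BY + κQ * κQ * BX * B₁ * θY)) *
        (g.len a ^ 2)⁻¹ * Real.exp (-(ρ * g.dist a b))) := by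
  have hw1 : ∀ a : g.Site, 0 ≤ g.len a := fun a => (hlen a).le
  -- the five summands of the telescope, one engine application each
  have t1 := hasMajorantHom_word349₂ (R := R) (H := H) blkI blkI blkX blkZ d δ₀ δ α β ρ Λ κQ κQ θX B₁ BY (fun a => g.len a) (fun a => g.len a)
    hw1 hw1 hκQ hκQ hθX hB₁ hBY hΛ hρ hα hβ hδ₀ hr hdnn htri h261 hT1 hT4 hdX hY₁ hQ₁ hQs₁ hC₁
  have t2 := hasMajorantHom_word349₂ (R := R) (H := H) blkI blkI blkX blkZ d δ₀ δ α β ρ Λ κQ θQ BX B₁ BY (fun a => g.len a) (fun a => g.len a)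
    hw1 hw1 hκQ hθQ hBX hB₁ hBY hΛ hρ hα hβ hδ₀ hr hdnn htri h261 hT1 hT4 hX₂ hY₁ hQ₁ hdQs hC₁
  have t3 := hasMajorantHom_word349₂ (R := R) (H := H) blkI blkI blkX blkZ d δ₀ δ α β ρ Λ κQ κQ BX θC BY (fun a => g.len a) (fun a => g.len a)
    hw1 hw1 hκQ hκQ hBX hθC hBY hΛ hρ hα hβ hδ₀ hr hdnn htri h261 hT1 hT4 hX₂ hY₁ hQ₁ hQs₂ hdC
  have t4 := hasMajorantHom_word349₂ (R := R) (H := H) blkI blkI blkX blkZ d δ₀ δ α β ρ Λ θQ κQ BX B₁ BY (fun a => g.len a) (fun a => g.len a)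
    hw1 hw1 hθQ hκQ hBX hB₁ hBY hΛ hρ hα hβ hδ₀ hr hdnn htri h261 hT1 hT4 hX₂ hY₁ hdQ hQs₂ hC₂
  have t5 := hasMajorantHom_word349₂ (R := R) (H := H) blkI blkI blkX blkZ d δ₀ δ α β ρ Λ κQ κQ BX B₁ θY (fun a => g.len a) (fun a => g.len a)
    hw1 hw1 hκQ hκQ hBX hB₁ hθY hΛ hρ hα hβ hδ₀ hr hdnn htri h261 hT1 hT4 hX₂ hdY hQ₂ hQs₂ hC₂
  have hsum := hasMajorantHom_add (g := toB6 g R H) blkI blkI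
    (hasMajorantHom_add (g := toB6 g R H) blkI blkI (hasMajorantHom_add (g := toB6 g R H) blkI blkI
      (hasMajorantHom_add (g := toB6 g R H) blkI blkI t1 t2) t3) t4) t5
  rw [← word_sub_word_telescope] at hsum
  refine (hasMajorantHom_iff (g := toB6 g R H) blkI _ _).mp (hasMajorantHom_mono (g := toB6 g R H) blkI blkI hsum fun a b => le_of_eq ?_)
  have h0 : g.len a ≠ 0 := (hlen a).ne'
  field_simp

end Main

end Literature.MathematicalPhysics.QuantumFieldTheory.Balaban1983to89.B9Ineq349WordDiffHom

end
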